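import Mathlib
import HarnessLib
import Summits.ValiantsHypothesis.ValiantsHypothesis.Theses.MonotoneRestoration
import Literature.Computability.AlgebraicComplexity.ArithCircuit
import Literature.Computability.AlgebraicComplexity.ArithCircuitProofs
import Literature.Computability.AlgebraicComplexity.MonotoneStructure
import Literature.Computability.AlgebraicComplexity.PermanentIrreducible
import Literature.ModelTheory.FiniteModelTheory.CkEquiv
import Summits.ValiantsHypothesis.ValiantsHypothesis.Theorems.MonotoneRestorationMonotoneRestorationQPCosetCount
import Summits.ValiantsHypothesis.ValiantsHypothesis.Theorems.MonotoneRestorationMonotoneRestorationQPSymmetricLB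
import Summits.ValiantsHypothesis.ValiantsHypothesis.Theorems.MonotoneRestorationMonotoneRestorationQPSupportSymmetrisation
import Summits.ValiantsHypothesis.ValiantsHypothesis.Theorems.MonotoneRestorationMonotoneRestorationQPSparseRegime
import Summits.ValiantsHypothesis.ValiantsHypothesis.Theorems.MonotoneRestorationMonotoneRestorationQPBeta
import Literature.Computability.AlgebraicComplexity.SymmetricArithCircuit
import Literature.Computability.AlgebraicComplexity.DawarWilsenach2025Proofs
import Literature.GroupTheory.PermutationGroups.SmallIndexSubgroups
import Summits.ValiantsHypothesis.ValiantsHypothesis.Theorems.MonotoneRestorationQP.Negative.LoadBearing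
import Summits.ValiantsHypothesis.ValiantsHypothesis.Theorems.MonotoneRestorationMonotoneRestorationQPPermSupportCount
import Literature.Computability.AlgebraicComplexity.RazElusiveGeneralRouteProofs

/-! TTRL-lite variant V19254 of stmt-ValiantsHypothesis-15886

Extension of scalars is free: `L(MvPolynomial.map φ f) ≤ L(f)` for every ring homomorphism
`φ : R →+* S` — map every constant and every sum coefficient of a minimal fan-in-two circuit for
`f` along `φ` (`ArithCircuit.map`); the mapped circuit has the same size, is still fan-in two, and
computes `MvPolynomial.map φ f` (Bürgisser 2000, §4.1). This is the tree's
`ArithCircuit.complexity_map_le` (`Literature/…/RazElusiveGeneralRouteProofs.lean`), which is not in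
the import closure of the MonotoneRestorationQP skeleton; this file imports it and re-exports the
statement in the variant's shape (explicit `R S σ`).
-/

-- `Summit.ValiantsHypothesis.ValiantsHypothesis.…` is the tree's mandated single-conjunct layout
-- (Sub = Summit), so the duplicated namespace component is intended.
set_option linter.dupNamespace false

namespace Summit.ValiantsHypothesis.ValiantsHypothesis.Theorems

open Summit.ValiantsHypothesis.ValiantsHypothesis.Theses.MonotoneRestoration
open Literature.Computability.AlgebraicComplexity

set_option linter.unusedVariables false in
/-- TTRL-lite variant V19254 of `stub_esymmRowSums_complexity` (stmt-ValiantsHypothesis-15886):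
extension of scalars is free, `complexity (MvPolynomial.map φ f) ≤ complexity f` for every ring
homomorphism `φ : R →+* S` of commutative semirings (Bürgisser 2000, §4.1; tree:
`ArithCircuit.complexity_map_le`). The instance binders carry the names `inst`, `inst'` of the
machine-generated variant statement (kept verbatim), whence the scoped `unusedVariables`
exemption. -/
theorem stub_esymmRowSums_complexity_var19254 :
    ∀ (R S σ : Type) [inst : CommSemiring R] [inst' : CommSemiring S] (φ : R →+* S)
      (f : MvPolynomial σ R), complexity (MvPolynomial.map φ f) ≤ complexity f := by
  intro R S σ _ _ φ f
  exact ArithCircuit.complexity_map_le φ f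

end Summit.ValiantsHypothesis.ValiantsHypothesis.Theorems
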